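import Mathlib
import HarnessLib
import Literature.MathematicalPhysics.QuantumLattice.AnisotropicSectors

/-!
# Route `KLProgramme`, crux K3 (stmt-HubbardSuperconductivity-19937) — ANGULAR LIPSCHITZ TRANSPORT: a `2π`-periodic Lipschitz angular
# function varies between two directions by at most `Λ·(π/2)·‖chord‖`, and between the polar angles of two nonzero momenta `p, q` by at
# most `Λ·π·‖p − q‖/‖p‖` (no branch-cut bookkeeping for `polarAngle = arg`)

Cell gate-hubbard-kl, seat p1b (g4).  Model-free step (2)/(5) of the child-2 closing route under the Δ18 repair (STATUS 2026-08-26 18:0xZ,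
p1b): child 2 (`KLRegimeCountertermV9`, stmt-…-19664) compares the angular data `φ = K∘k_F − ν_N` (θ-Lipschitz by (E3g) at order 1 and
the frame's curve speed) at the polar angles of NEARBY momenta — a flat-tube lattice point and the lattice point nearest to an off-lattice
curve point.  `polarAngle = Complex.arg ∘ momToComplex` jumps by `2π` across the negative axis, so the comparison is done through the unit
vectors `e^{iθ(p)} = p/‖p‖`:
* `abs_sub_le_mul_norm_cexp_sub` — for `φ` `2π`-periodic and `Λ`-Lipschitz: `|φ a − φ b| ≤ Λ·(π/2)·‖e^{ia} − e^{ib}‖` (chord–arc, Jordan);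
* `norm_cexp_arg_sub_le` — `‖e^{i arg z} − e^{i arg w}‖ ≤ 2‖z − w‖/‖z‖` for `z, w ≠ 0`;
* **`abs_sub_polarAngle_le`** — `|φ(θ(p)) − φ(θ(q))| ≤ Λ·π·‖p − q‖_ℂ/‖p‖_ℂ` for nonzero momenta (`‖·‖_ℂ` the Euclidean norm via
  `momToComplex`), and `norm_momToComplex_sub_le` (`≤ |p₀−q₀| + |p₁−q₁|`), `abs_apply_le_norm_momToComplex` (`|pᵢ| ≤ ‖p‖_ℂ`) for the
  sup-metric bookkeeping of `exists_latticeMomentum_near` (`…SplitSymInterpBounds`).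
Proofs only; nothing is asserted about the model.
-/

noncomputable section

namespace Summit.HubbardSuperconductivity.HubbardSuperconductivity.Theorems.KLRegimeSplit

set_option linter.dupNamespace false -- summit = problem name (single-conjunct summit), D-0017

open Real Literature.MathematicalPhysics.QuantumLattice

/-! ## §1 Chord–arc: periodic Lipschitz functions of the angle through unit vectors -/

/-- **Jordan's chord–arc inequality**: for `d ∈ [−π, π]`, `|d| ≤ (π/2)·‖e^{id} − 1‖`. -/
theorem abs_le_pi_div_two_mul_norm_cexp_sub_one {d : ℝ} (hd : |d| ≤ π) :
    |d| ≤ π / 2 * ‖Complex.exp (Complex.I * d) - 1‖ := by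
  rw [Complex.norm_exp_I_mul_ofReal_sub_one, Real.norm_eq_abs, abs_mul, abs_two]
  have hpi : 0 < π := Real.pi_pos
  -- `|sin(d/2)| ≥ (2/π)|d/2|` since `|d/2| ≤ π/2`
  have hkey : 2 / π * |d / 2| ≤ |Real.sin (d / 2)| := by
    have h1 : 0 ≤ |d / 2| := abs_nonneg _
    have h2 : |d / 2| ≤ π / 2 := by rw [abs_div, abs_two]; linarith
    have h3 := Real.mul_le_sin h1 h2
    -- `sin |x| = |sin x|` in absolute value for `|x| ≤ π/2`... use `|sin x| = sin |x|`
    obtain ⟨hd1, hd2⟩ := abs_le.1 hd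
    have h4 : Real.sin |d / 2| = |Real.sin (d / 2)| := by
      rcases le_or_gt 0 (d / 2) with h | h
      · rw [abs_of_nonneg h, abs_of_nonneg (Real.sin_nonneg_of_nonneg_of_le_pi h (by linarith))]
      · rw [abs_of_neg h, Real.sin_neg, abs_of_neg (Real.sin_neg_of_neg_of_neg_pi_lt h (by linarith))]
    rw [← h4]; exact h3
  rw [abs_div, abs_two] at hkey
  have : |d| = π / 2 * (2 * (2 / π * (|d| / 2))) := by field_simp
  rw [this]
  exact mul_le_mul_of_nonneg_left (by linarith) (by positivity)

/-- **A `2π`-periodic `Λ`-Lipschitz angular function through the chord**: `|φ a − φ b| ≤ Λ·(π/2)·‖e^{ia} − e^{ib}‖`. -/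
theorem abs_sub_le_mul_norm_cexp_sub {φ : ℝ → ℝ} (hper : Function.Periodic φ (2 * π)) {Λ : ℝ} (hΛ : 0 ≤ Λ)
    (hLip : ∀ a b, |φ a - φ b| ≤ Λ * |a - b|) (a b : ℝ) :
    |φ a - φ b| ≤ Λ * (π / 2) * ‖Complex.exp (Complex.I * a) - Complex.exp (Complex.I * b)‖ := by
  have hp : (0 : ℝ) < 2 * π := Real.two_pi_pos
  -- reduce `a - b` modulo `2π` into `(-π, π]`
  set d : ℝ := toIocMod hp (-π) (a - b) with hd
  set k : ℤ := toIocDiv hp (-π) (a - b) with hk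
  have hdk : a - b = d + k • (2 * π) := by
    rw [hd, toIocMod]; abel
  have hdmem : d ∈ Set.Ioc (-π) (-π + 2 * π) := toIocMod_mem_Ioc hp (-π) (a - b)
  have hdabs : |d| ≤ π := by
    rw [abs_le]; constructor <;> [linarith [hdmem.1]; linarith [hdmem.2]]
  -- `φ a = φ (b + d)` by periodicity
  have hφ : φ a = φ (b + d) := by
    have h1 : a = b + d + k * (2 * π) := by rw [zsmul_eq_mul] at hdk; linarith
    rw [h1]
    exact hper.int_mul k (b + d)
  -- the chord: `‖e^{ia} − e^{ib}‖ = ‖e^{id} − 1‖`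
  have hchord : ‖Complex.exp (Complex.I * a) - Complex.exp (Complex.I * b)‖ = ‖Complex.exp (Complex.I * d) - 1‖ := by
    have hsplit : Complex.exp (Complex.I * a) = Complex.exp (Complex.I * b) * Complex.exp (Complex.I * d) := by
      rw [← Complex.exp_add]
      have : Complex.I * (a : ℂ) = Complex.I * b + Complex.I * d + (k : ℂ) * (2 * π * Complex.I) := by
        have h1 : (a : ℂ) = b + d + (k : ℝ) * (2 * π) := by
          rw [zsmul_eq_mul] at hdk; exact_mod_cast (show a = b + d + (k : ℝ) * (2 * π) by linarith)
        rw [h1]; push_cast; ring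
      rw [this, Complex.exp_add, Complex.exp_int_mul_two_pi_mul_I, mul_one]
    rw [hsplit, ← mul_sub_one, norm_mul, Complex.norm_exp_I_mul_ofReal, one_mul]
  rw [hφ, hchord]
  calc |φ (b + d) - φ b| ≤ Λ * |b + d - b| := hLip _ _
    _ = Λ * |d| := by rw [add_sub_cancel_left]
    _ ≤ Λ * (π / 2 * ‖Complex.exp (Complex.I * d) - 1‖) :=
        mul_le_mul_of_nonneg_left (abs_le_pi_div_two_mul_norm_cexp_sub_one hdabs) hΛ
    _ = Λ * (π / 2) * ‖Complex.exp (Complex.I * d) - 1‖ := by ring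

/-! ## §2 Unit vectors of nearby points are close -/

/-- **`‖z/‖z‖ − w/‖w‖‖ ≤ 2‖z − w‖/‖z‖`** for `z ≠ 0`, `w ≠ 0`. -/
theorem norm_div_norm_sub_div_norm_le {z w : ℂ} (hz : z ≠ 0) (hw : w ≠ 0) :
    ‖z / (‖z‖ : ℂ) - w / (‖w‖ : ℂ)‖ ≤ 2 * ‖z - w‖ / ‖z‖ := by
  have hz' : 0 < ‖z‖ := norm_pos_iff.2 hz
  have hw' : 0 < ‖w‖ := norm_pos_iff.2 hw
  have hz1 : (‖z‖ : ℂ) ≠ 0 := by exact_mod_cast hz'.ne'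
  have hw1 : (‖w‖ : ℂ) ≠ 0 := by exact_mod_cast hw'.ne'
  have e : z / (‖z‖ : ℂ) - w / (‖w‖ : ℂ) = (z - w) / (‖z‖ : ℂ) + w * ((‖w‖ : ℂ) - ‖z‖) / ((‖z‖ : ℂ) * ‖w‖) := by
    field_simp
    ring
  rw [e]
  refine (norm_add_le _ _).trans ?_
  rw [norm_div, Complex.norm_real, Real.norm_eq_abs, abs_of_pos hz', norm_div, norm_mul, norm_mul, Complex.norm_real,
    Complex.norm_real, Real.norm_eq_abs, Real.norm_eq_abs, abs_of_pos hz', abs_of_pos hw']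
  have h2 : ‖(‖w‖ : ℂ) - (‖z‖ : ℂ)‖ ≤ ‖z - w‖ := by
    rw [← Complex.ofReal_sub, Complex.norm_real, Real.norm_eq_abs, abs_sub_comm]
    exact abs_norm_sub_norm_le z w
  have h3 : ‖w‖ * ‖(‖w‖ : ℂ) - (‖z‖ : ℂ)‖ / (‖z‖ * ‖w‖) ≤ ‖z - w‖ / ‖z‖ := by
    rw [mul_comm ‖w‖, mul_div_mul_right _ _ hw'.ne']
    exact div_le_div_of_nonneg_right h2 hz'.le
  calc ‖z - w‖ / ‖z‖ + ‖w‖ * ‖(‖w‖ : ℂ) - (‖z‖ : ℂ)‖ / (‖z‖ * ‖w‖) ≤ ‖z - w‖ / ‖z‖ + ‖z - w‖ / ‖z‖ := by linarith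
    _ = 2 * ‖z - w‖ / ‖z‖ := by ring

/-- `e^{i·arg z} = z/‖z‖` for `z ≠ 0`. -/
theorem cexp_I_mul_arg_eq_div (z : ℂ) (hz : z ≠ 0) : Complex.exp (Complex.I * (Complex.arg z)) = z / (‖z‖ : ℂ) := by
  have h := Complex.norm_mul_exp_arg_mul_I z
  have hz' : (‖z‖ : ℂ) ≠ 0 := by exact_mod_cast (norm_pos_iff.2 hz).ne'
  rw [mul_comm, eq_div_iff hz', mul_comm]
  exact h

/-- **`‖e^{i arg z} − e^{i arg w}‖ ≤ 2‖z − w‖/‖z‖`** for nonzero `z, w`. -/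
theorem norm_cexp_arg_sub_le {z w : ℂ} (hz : z ≠ 0) (hw : w ≠ 0) :
    ‖Complex.exp (Complex.I * (Complex.arg z)) - Complex.exp (Complex.I * (Complex.arg w))‖ ≤ 2 * ‖z - w‖ / ‖z‖ := by
  rw [cexp_I_mul_arg_eq_div z hz, cexp_I_mul_arg_eq_div w hw]
  exact norm_div_norm_sub_div_norm_le hz hw

/-! ## §3 Polar angles of nearby momenta -/

/-- `|pᵢ| ≤ ‖p‖_ℂ` (the Euclidean norm dominates each coordinate). -/
theorem abs_apply_le_norm_momToComplex (p : Fin 2 → ℝ) (i : Fin 2) : |p i| ≤ ‖momToComplex p‖ := by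
  fin_cases i
  · simpa using Complex.abs_re_le_norm (momToComplex p)
  · simpa using Complex.abs_im_le_norm (momToComplex p)

/-- `momToComplex` is additive/subtractive coordinatewise: `‖p − q‖_ℂ ≤ |p₀ − q₀| + |p₁ − q₁|`. -/
theorem norm_momToComplex_sub_le (p q : Fin 2 → ℝ) :
    ‖momToComplex p - momToComplex q‖ ≤ |p 0 - q 0| + |p 1 - q 1| := by
  have hre : (momToComplex p - momToComplex q).re = p 0 - q 0 := by simp
  have him : (momToComplex p - momToComplex q).im = p 1 - q 1 := by simp
  have h := Complex.norm_le_abs_re_add_abs_im (momToComplex p - momToComplex q)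
  rwa [hre, him] at h

/-- **ANGULAR LIPSCHITZ TRANSPORT TO MOMENTA**: for a `2π`-periodic `Λ`-Lipschitz `φ` and nonzero momenta `p, q`,
`|φ(polarAngle p) − φ(polarAngle q)| ≤ Λ·π·‖p − q‖_ℂ/‖p‖_ℂ`. -/
theorem abs_sub_polarAngle_le {φ : ℝ → ℝ} (hper : Function.Periodic φ (2 * π)) {Λ : ℝ} (hΛ : 0 ≤ Λ)
    (hLip : ∀ a b, |φ a - φ b| ≤ Λ * |a - b|) {p q : Fin 2 → ℝ} (hp : p ≠ 0) (hq : q ≠ 0) :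
    |φ (polarAngle p) - φ (polarAngle q)| ≤ Λ * π * (‖momToComplex p - momToComplex q‖ / ‖momToComplex p‖) := by
  have hz : momToComplex p ≠ 0 := fun h => hp ((momToComplex_eq_zero_iff p).1 h)
  have hw : momToComplex q ≠ 0 := fun h => hq ((momToComplex_eq_zero_iff q).1 h)
  have h1 := abs_sub_le_mul_norm_cexp_sub hper hΛ hLip (polarAngle p) (polarAngle q)
  have h2 := norm_cexp_arg_sub_le hz hw
  unfold polarAngle at h1 ⊢
  have hnn : 0 ≤ Λ * (π / 2) := by positivity
  calc |φ (Complex.arg (momToComplex p)) - φ (Complex.arg (momToComplex q))|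
      ≤ Λ * (π / 2) * ‖Complex.exp (Complex.I * (Complex.arg (momToComplex p))) -
          Complex.exp (Complex.I * (Complex.arg (momToComplex q)))‖ := h1
    _ ≤ Λ * (π / 2) * (2 * ‖momToComplex p - momToComplex q‖ / ‖momToComplex p‖) := mul_le_mul_of_nonneg_left h2 hnn
    _ = Λ * π * (‖momToComplex p - momToComplex q‖ / ‖momToComplex p‖) := by ring

/-- **Sup-metric form**: if `|pᵢ − qᵢ| ≤ η` for both coordinates and `r ≤ ‖p‖_ℂ` with `r > 0`, then
`|φ(polarAngle p) − φ(polarAngle q)| ≤ Λ·π·(2η/r)`. -/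
theorem abs_sub_polarAngle_le_of_sup {φ : ℝ → ℝ} (hper : Function.Periodic φ (2 * π)) {Λ : ℝ} (hΛ : 0 ≤ Λ)
    (hLip : ∀ a b, |φ a - φ b| ≤ Λ * |a - b|) {p q : Fin 2 → ℝ} (hp : p ≠ 0) (hq : q ≠ 0) {η r : ℝ} (hr : 0 < r)
    (hrp : r ≤ ‖momToComplex p‖) (hη : ∀ i, |p i - q i| ≤ η) :
    |φ (polarAngle p) - φ (polarAngle q)| ≤ Λ * π * (2 * η / r) := by
  refine (abs_sub_polarAngle_le hper hΛ hLip hp hq).trans (mul_le_mul_of_nonneg_left ?_ (by positivity))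
  have hnum : ‖momToComplex p - momToComplex q‖ ≤ 2 * η := by
    refine (norm_momToComplex_sub_le p q).trans ?_
    have := hη 0; have := hη 1; linarith
  have hz : 0 < ‖momToComplex p‖ := hr.trans_le hrp
  calc ‖momToComplex p - momToComplex q‖ / ‖momToComplex p‖ ≤ 2 * η / ‖momToComplex p‖ :=
        div_le_div_of_nonneg_right hnum hz.le
    _ ≤ 2 * η / r := by
        apply div_le_div_of_nonneg_left _ hr hrp
        have := hη 0; linarith [abs_nonneg (p 0 - q 0)]

end Summit.HubbardSuperconductivity.HubbardSuperconductivity.Theorems.KLRegimeSplit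

end
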